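import Literature.IUT.LogVolume.ThetaTowerRamification
import HarnessLib

/-!
# [IUTchIV] Thm. 1.10, Step (iii) (D0): the GENUINE theta tower `F_tpd ⊆ F ⊆ K` is UNRAMIFIED over the
# good places `v ∤ 2·3·5·l` of `λ`

Mochizuki, *Inter-universal Teichmüller theory IV*, RIMS manuscript (Apr. 2020; = PRIMS **57** (2021)),
proof of Thm. 1.10, Step (iii), p. 26: "(D0) if `v ∈ 𝕍(F_tpd)^non` does not divide `2·3·5·l` and, moreover, is
not contained in `Supp(𝔮^{F_tpd}_ADiv)`, then the extension `K/F_tpd` is unramified over `v`" — "it follows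
immediately from Proposition 1.8, (vi), (vii), together with our assumption on `𝕍(F)^good ∩ 𝕍(F)^non`".
Sequel of `ThetaTowerRamification.lean` (same setting: `P : NFPoint` presenting `λ ∈ U_X` over `F_tpd = P.F`,
`F` a theta field of `P`, `K ⊆ F(E_F[l])` Galois over `F` presented by `ψ : K → F̄`). PROVED (classical):

* `valuation_legendre_eq_one_of_valuation_jInv_le_one`, `legendreCurve_hasGoodReductionAt` — at a place
  `v ∤ 2` of `F_tpd` with `|j(λ)|_v ≤ 1` one has `|λ|_v = |λ−1|_v = 1`, so the Legendre equation
  `y² = x(x−1)(x−λ)` ITSELF has good reduction at `v` (Prop. 1.8 (vi): "if `E_k` has good reduction over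
  `O_{k′}` …, then one may in fact take `k′` to be `k`"; Silverman, proof of VII.5.4 (c));
* `ramificationIdx_thetaField_eq_one` — **`F/F_tpd` is unramified at every good place `v ∤ 2·3·5` of `λ`**:
  `F = F_tpd(√−1, E_{F_tpd}[3·5])` and the absolute inertia group at `v` fixes `√−1` (`v ∤ 2`) and the
  `15`-torsion points of the good-reduction curve `E_{F_tpd}` (`v ∤ 15`, Silverman VII.4.1), hence their
  coordinates, hence `F`;
* `ramificationIdx_divisionTower_tpd_eq_one` — **(D0)**: `e(u|v) = e(u|w)·e(w|v) = 1` for every place `u` of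
  `K` over a good place `v ∤ 2·3·5·l`.

Theorems only; classical (torsion fields of the Legendre curve), kernel-checked by us; TAKES NO SIDE on
[IUTchIII] Cor. 3.12.
-/

noncomputable section

open scoped Classical

namespace Literature.IUT.LogVolume

namespace Cor22

open NumberField IsDedekindDomain Literature.NumberTheory.DiophantineGeometry.GenEll
open Literature.NumberTheory.EllipticCurves Literature.NumberTheory.GaloisRepresentations
open Literature.NumberTheory.NumberFields WeierstrassCurve IntermediateField Field

variable {P : NFPoint} (F : Type) [Field F] [NumberField F] [Algebra P.F F]

/-! ## The Legendre equation at a good odd place of `F_tpd` -/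

/-- **`|λ|_w = |λ − 1|_w = 1` when `|2|_w = 1` and `|j(λ)|_w ≤ 1`** (`λ ≠ 0, 1`): the three other cases
`|λ| > 1`, `|λ| < 1`, `|λ| = 1 > |λ−1|` give `|j(λ)| = |λ|², |λ|⁻², |λ−1|⁻² > 1` respectively (Silverman,
proof of Prop. VII.5.4 (c) / VII.5.5; the tree's `one_lt_val_j_legendre` over `ℝ≥0`, here for an arbitrary
value group). [cite: SilvermanAEC2009, proof of Prop. VII.5.4(c) (PDF p. 176) and Prop. VII.5.5] -/
theorem valuation_legendre_eq_one_of_valuation_jInv_le_one {L Γ₀ : Type*} [Field L]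
    [LinearOrderedCommGroupWithZero Γ₀] (w : Valuation L Γ₀) (h2 : w 2 = 1) {la : L} (h0 : la ≠ 0)
    (h1 : la ≠ 1) (hj : w (jInv la) ≤ 1) : w la = 1 ∧ w (la - 1) = 1 := by
  have h1' : la - 1 ≠ 0 := sub_ne_zero.mpr h1
  have hden : la ^ 2 * (la - 1) ^ 2 ≠ 0 := mul_ne_zero (pow_ne_zero _ h0) (pow_ne_zero _ h1')
  -- `j(λ)·λ²(λ−1)² = 2⁸(λ²−λ+1)³`, so `|λ²−λ+1|³ ≤ |λ|²·|λ−1|²`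
  have hmul : jInv la * (la ^ 2 * (la - 1) ^ 2) = 2 ^ 8 * (la ^ 2 - la + 1) ^ 3 := by
    unfold jInv; rw [div_mul_cancel₀ _ hden]
  have key : w (la ^ 2 - la + 1) ^ 3 ≤ w la ^ 2 * w (la - 1) ^ 2 := by
    have h := congrArg w hmul
    simp only [map_mul, map_pow, h2, one_pow, one_mul] at h
    rw [← h]
    calc w (jInv la) * (w la ^ 2 * w (la - 1) ^ 2) ≤ 1 * (w la ^ 2 * w (la - 1) ^ 2) :=
          mul_le_mul' hj le_rfl
      _ = w la ^ 2 * w (la - 1) ^ 2 := one_mul _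
  have ha0 : 0 < w la := (Valuation.pos_iff _).mpr h0
  have hb0 : 0 < w (la - 1) := (Valuation.pos_iff _).mpr h1'
  rcases lt_trichotomy (w la) 1 with hlt | heq | hgt
  · -- `|λ| < 1`: `|λ−1| = 1`, `|λ²−λ+1| = 1`, so `1 ≤ |λ|² < 1`
    exfalso
    have hb : w (la - 1) = 1 := by rw [Valuation.map_sub_swap, Valuation.map_one_sub_of_lt _ hlt]
    have hc : w (la ^ 2 - la + 1) = 1 := by
      rw [show la ^ 2 - la + 1 = 1 + la * (la - 1) by ring]
      refine Valuation.map_one_add_of_lt _ ?_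
      rw [map_mul, hb, mul_one]; exact hlt
    rw [hc, hb, one_pow, one_pow, mul_one] at key
    exact absurd key (not_le.mpr (pow_lt_one₀ ha0.le hlt two_ne_zero))
  · -- `|λ| = 1`: then `|λ−1| ≤ 1`, and `|λ−1| < 1` would give `1 ≤ |λ−1|² < 1`
    refine ⟨heq, ?_⟩
    have hble : w (la - 1) ≤ 1 := by
      calc w (la - 1) ≤ max (w la) (w 1) := Valuation.map_sub _ _ _
        _ = 1 := by rw [heq, map_one, max_self]
    rcases hble.lt_or_eq with hblt | hbeq
    · exfalso
      have hc : w (la ^ 2 - la + 1) = 1 := by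
        rw [show la ^ 2 - la + 1 = 1 + (la - 1) * la by ring]
        refine Valuation.map_one_add_of_lt _ ?_
        rw [map_mul, heq, mul_one]; exact hblt
      rw [hc, heq, one_pow, one_pow, one_mul] at key
      exact absurd key (not_le.mpr (pow_lt_one₀ hb0.le hblt two_ne_zero))
    · exact hbeq
  · -- `|λ| > 1`: `|λ−1| = |λ|`, `|λ²−λ+1| = |λ|²`, so `|λ|⁶ ≤ |λ|⁴`
    exfalso
    have hb : w (la - 1) = w la := by
      refine Valuation.map_sub_eq_of_lt_left _ ?_
      rw [map_one]; exact hgt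
    have hc : w (la ^ 2 - la + 1) = w la ^ 2 := by
      have hlt1 : w (-la + 1) < w (la ^ 2) := by
        calc w (-la + 1) ≤ max (w (-la)) (w 1) := Valuation.map_add _ _ _
          _ = w la := by rw [Valuation.map_neg, map_one, max_eq_left hgt.le]
          _ < w la * w la := lt_mul_of_one_lt_right ha0 hgt
          _ = w (la ^ 2) := by rw [map_pow, pow_two]
      rw [show la ^ 2 - la + 1 = la ^ 2 + (-la + 1) by ring, Valuation.map_add_eq_of_lt_left _ hlt1,
        map_pow]
    rw [hc, hb, ← pow_mul, ← pow_add] at key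
    norm_num at key
    -- `|λ|^6 ≤ |λ|^4` contradicts `|λ| > 1`
    have : w la ^ 4 < w la ^ 6 := pow_lt_pow_right₀ hgt (by norm_num)
    exact absurd key (not_le.mpr this)

/-- **The Legendre equation `y² = x(x−1)(x−λ)` has good reduction at every place `v ∤ 2` of `F_tpd` at
which `j(λ)` is integral** (`|λ|_v = |λ−1|_v = 1`, so the equation is `v`-integral with unit discriminant
`16λ²(λ−1)²`): the "one may in fact take `k′` to be `k`" clause of Prop. 1.8 (vi) — at odd places the
Legendre curve is never additive with potentially good reduction. [cite: Mochizuki2012, IUTchIV Prop 1.8 (vi) p.19]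
[cite: SilvermanAEC2009, proof of Prop. VII.5.4(c) (PDF p. 176)] -/
theorem legendreCurve_hasGoodReductionAt (hU : P.InU) (v : HeightOneSpectrum (𝓞 P.F))
    (h2 : ((2 : ℕ) : 𝓞 P.F) ∉ v.asIdeal) (hv : v ∉ badPlaces P) :
    P.legendreCurve.HasGoodReductionAt v := by
  have hj : v.valuation P.F (jInv P.x) ≤ 1 := by
    by_contra h
    apply hv
    unfold badPlaces
    rw [Set.Finite.mem_toFinset]
    exact not_le.mp h
  have hw2 : v.valuation P.F (2 : P.F) = 1 := by
    apply le_antisymm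
    · have h : v.valuation P.F (algebraMap (𝓞 P.F) P.F ((2 : ℕ) : 𝓞 P.F)) ≤ 1 :=
        v.valuation_le_one _
      rwa [map_natCast, Nat.cast_ofNat] at h
    · have h' : ¬ v.valuation P.F (algebraMap (𝓞 P.F) P.F ((2 : ℕ) : 𝓞 P.F)) < 1 := by
        rw [HeightOneSpectrum.valuation_lt_one_iff_mem]; exact h2
      rw [map_natCast, Nat.cast_ofNat] at h'
      exact not_lt.mp h'
  obtain ⟨hla, hla1⟩ := valuation_legendre_eq_one_of_valuation_jInv_le_one (v.valuation P.F) hw2 hU.1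
    hU.2 hj
  refine WeierstrassCurve.hasGoodReductionAt_of_valuation_le_one_of_valuation_Δ_eq_one v P.legendreCurve
    (by simp) ?_ (by simp) hla.le (by simp) ?_
  · show v.valuation P.F (-(1 + P.x)) ≤ 1
    rw [Valuation.map_neg]
    exact (v.valuation P.F).map_add_le (le_of_eq (map_one _)) hla.le
  · show v.valuation P.F (WeierstrassCurve.Δ _) = 1
    rw [legendre_Δ, map_mul, map_mul, map_pow, map_pow, hla, hla1,
      show (16 : P.F) = 2 ^ 4 by norm_num, map_pow, hw2]
    simp

/-! ## The layer `F/F_tpd` is unramified at the good places not dividing `2·3·5` -/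

/-- **`F/F_tpd` is unramified over every good place `v ∤ 2·3·5` of `λ`** (Prop. 1.8 (vi), (vii) as used in
Step (ii)/(D0): `F = F_tpd(√−1, E_{F_tpd}[3·5])`, the Legendre curve `E_{F_tpd}` has good reduction at
`v`, so the absolute inertia group at `v` fixes `√−1` (`v ∤ 2`) and the `15`-torsion points (`v ∤ 15`,
Silverman VII.4.1), hence their coordinates, hence `F`): `e(w|v) = 1` for every place `w` of `F` over `v`.
[cite: Mochizuki2012, IUTchIV Thm 1.10 proof Step (iii) (D0) p.26] [cite: SilvermanAEC2009, Prop. VII.4.1(a)] -/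
theorem ramificationIdx_thetaField_eq_one (hU : P.InU) (hF : IsThetaField P F) (w : HeightOneSpectrum (𝓞 F))
    (h30 : ((30 : ℕ) : 𝓞 P.F) ∉ (finBelow P.F F w).asIdeal) (hgood : finBelow P.F F w ∉ badPlaces P) :
    w.asIdeal.ramificationIdx (𝓞 P.F) = 1 := by
  haveI : P.legendreCurve.IsElliptic := P.legendreCurve_isElliptic_iff.2 hU
  set v := finBelow P.F F w with hvdef
  -- divisibility bookkeeping at `v`
  have hnat : ∀ {m : ℕ}, m ∣ 30 → ((m : ℕ) : 𝓞 P.F) ∉ v.asIdeal := by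
    intro m hm h
    apply h30
    obtain ⟨c, hc⟩ := hm
    rw [hc, Nat.cast_mul]
    exact v.asIdeal.mul_mem_right _ h
  have h2 : ((2 : ℕ) : 𝓞 P.F) ∉ v.asIdeal := hnat ⟨15, by norm_num⟩
  have h4 : ((4 : ℕ) : 𝓞 P.F) ∉ v.asIdeal := by
    intro h
    haveI := v.isPrime
    have : ((2 : ℕ) : 𝓞 P.F) * ((2 : ℕ) : 𝓞 P.F) ∈ v.asIdeal := by
      rw [← Nat.cast_mul]; exact h
    rcases (Ideal.IsPrime.mem_or_mem inferInstance this) with h' | h' <;> exact h2 h'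
  have h15 : ((15 : ℕ) : 𝓞 P.F) ∉ v.asIdeal := hnat ⟨2, by norm_num⟩
  have hgoodred : P.legendreCurve.HasGoodReductionAt v := legendreCurve_hasGoodReductionAt hU v h2 hgood
  -- `F ≃ F_tpd(φ S) ⊆ F̄_tpd`, `S = {√−1} ∪ (15-torsion coordinates)`
  haveI : FiniteDimensional P.F F := Module.Finite.of_restrictScalars_finite ℚ P.F F
  set Ω := AlgebraicClosure P.F
  let φ : F →ₐ[P.F] Ω := IsAlgClosed.lift
  set S : Set F := {i : F | i ^ 2 = -1} ∪ torsionCoords P F with hSdef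
  set L : IntermediateField P.F Ω := IntermediateField.adjoin P.F (φ '' S) with hLdef
  have hL : φ.fieldRange = L := by
    rw [AlgHom.fieldRange_eq_map, ← hF.adjoin_eq_top, IntermediateField.adjoin_map]
  let e : F ≃ₐ[P.F] L :=
    (((IntermediateField.topEquiv (F := P.F) (E := F)).symm.trans (IntermediateField.equivMap ⊤ φ)).trans
      (IntermediateField.equivOfEq (AlgHom.fieldRange_eq_map φ).symm)).trans
      (IntermediateField.equivOfEq hL)
  haveI : FiniteDimensional P.F L := LinearEquiv.finiteDimensional e.toLinearEquiv
  haveI : IsGalois P.F L := by haveI := hF.isGalois; exact IsGalois.of_algEquiv e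
  haveI : NumberField L := NumberField.of_module_finite P.F L
  -- the inertia group at `v` fixes `φ S`
  obtain ⟨𝔓, h𝔓⟩ := HeightOneSpectrum.primesAbove_nonempty v
  have hS : ∀ σ ∈ 𝔓.inertia (absoluteGaloisGroup P.F), ∀ s ∈ φ '' S, σ • s = s := by
    intro σ hσ s hs
    obtain ⟨x, hx, rfl⟩ := hs
    rcases hx with hx | hx
    · -- `x = ±√−1`: a `4`-th root of unity
      have hx4 : (φ x) ^ 4 = 1 := by
        have : x ^ 4 = 1 := by
          rw [show (4 : ℕ) = 2 * 2 by norm_num, pow_mul, (hx : x ^ 2 = -1)]; norm_num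
        rw [← map_pow, this, map_one]
      exact smul_eq_of_mem_inertia_of_pow_eq_one v h𝔓 hσ h4 hx4
    · -- `x` a coordinate of a `15`-torsion point `T` of `E_F = E_{F_tpd} ⊗ F`
      rw [torsionCoords_eq] at hx
      obtain ⟨T, hT, hxT⟩ := Set.mem_iUnion₂.1 hx
      have hT15 : (15 : ℤ) • T = 0 := hT
      -- transport `T` to `E(F̄_tpd)` along `φ`
      let T' : geomPoints P.legendreCurve := Affine.Point.map (W' := P.legendreCurve.toAffine) φ T
      have hT' : (15 : ℤ) • T' = 0 := by
        change (15 : ℤ) • Affine.Point.map (W' := P.legendreCurve.toAffine) φ T = 0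
        rw [← map_zsmul, hT15, map_zero]
      have hmem : T' ∈ geomTorsion P.legendreCurve (15 : ℤ) := by
        change T' ∈ AddSubgroup.torsionBy (geomPoints P.legendreCurve) _
        rw [AddSubgroup.torsionBy, Submodule.mem_toAddSubgroup, Submodule.mem_torsionBy_iff]
        exact hT'
      have hfix : σ • T' = T' := by
        have := P.legendreCurve.smul_geomTorsion_eq_of_mem_inertia hgoodred (n := (15 : ℤ))
          (by exact_mod_cast h15) h𝔓 hσ ⟨T', hmem⟩
        exact congrArg Subtype.val this
      refine forall_coords_of_smul_eq P σ T' hfix (φ x) ?_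
      -- `φ x` is a coordinate of `T'`
      rcases T with _ | ⟨a, b, hab⟩
      · simp [pointCoords] at hxT
      · change φ x ∈ pointCoords (Affine.Point.map (W' := P.legendreCurve.toAffine) φ (Affine.Point.some a b hab))
        rw [Affine.Point.map_some]
        simp only [pointCoords, Set.mem_insert_iff, Set.mem_singleton_iff] at hxT ⊢
        rcases hxT with rfl | rfl
        · exact Or.inl rfl
        · exact Or.inr rfl
  -- hence every prime of `𝓞 L` over `v` is unramified, in particular the one corresponding to `w`
  set Q : Ideal (𝓞 L) := w.asIdeal.map (RingOfIntegers.mapAlgEquiv e : 𝓞 F ≃ₐ[𝓞 P.F] 𝓞 L) with hQ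
  haveI : Q.IsPrime := isPrime_map_mapAlgEquiv e w
  haveI : Q.LiesOver v.asIdeal := liesOver_map_mapAlgEquiv e w _
  rw [← ramificationIdx_map_mapAlgEquiv e w]
  exact ramificationIdx_adjoin_eq_one_of_forall_smul_eq v (φ '' S) h𝔓 hS Q

/-- **(D0) for the genuine tower**: `K/F_tpd` is unramified over every good place `v ∤ 2·3·5·l` of `λ`:
`e(u|v) = e(u|w)·e(w|v) = 1` (Step (iii), p. 26: "it follows immediately from Proposition 1.8, (vi), (vii),
together with our assumption on `𝕍(F)^good ∩ 𝕍(F)^non`, that (D0) …").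
[cite: Mochizuki2012, IUTchIV Thm 1.10 proof Step (iii) (D0) p.26] -/
theorem ramificationIdx_divisionTower_tpd_eq_one (hU : P.InU) (hF : IsThetaField P F) {K : Type} [Field K]
    [NumberField K] [Algebra F K] [Algebra P.F K] [IsScalarTower P.F F K] [IsGalois F K]
    (ψ : K →ₐ[F] AlgebraicClosure F) {l : ℕ}
    (hK : letI := thetaCurve_isElliptic hU F
      ((thetaCurve P F).galoisRepTorsion (l : ℤ)).ker ≤ ψ.fieldRange.fixingSubgroup)
    (u : HeightOneSpectrum (𝓞 K)) (h30 : ((30 : ℕ) : 𝓞 P.F) ∉ (finBelow P.F K u).asIdeal)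
    (hlu : ((l : ℕ) : 𝓞 P.F) ∉ (finBelow P.F K u).asIdeal)
    (hgood : finBelow P.F K u ∉ badPlaces P) :
    u.asIdeal.ramificationIdx (𝓞 P.F) = 1 := by
  have htower : finBelow P.F F (finBelow F K u) = finBelow P.F K u := by
    apply HeightOneSpectrum.ext
    change (u.asIdeal.under (𝓞 F)).under (𝓞 P.F) = u.asIdeal.under (𝓞 P.F)
    rw [Ideal.under_under]
  have hluF : ((l : ℕ) : 𝓞 F) ∉ (finBelow F K u).asIdeal := by
    intro h
    apply hlu
    rw [← htower]
    change ((l : ℕ) : 𝓞 P.F) ∈ Ideal.comap (algebraMap (𝓞 P.F) (𝓞 F)) (finBelow F K u).asIdeal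
    rw [Ideal.mem_comap, map_natCast]
    exact h
  have h1 : u.asIdeal.ramificationIdx (𝓞 F) = 1 :=
    ramificationIdx_divisionTower_eq_one ψ hU hF hK u hluF (by rw [htower]; exact hgood)
  have h2 : (finBelow F K u).asIdeal.ramificationIdx (𝓞 P.F) = 1 :=
    ramificationIdx_thetaField_eq_one F hU hF (finBelow F K u) (by rw [htower]; exact h30)
      (by rw [htower]; exact hgood)
  haveI : u.asIdeal.LiesOver (finBelow F K u).asIdeal := inferInstance
  rw [Ideal.ramificationIdx_tower (finBelow F K u).asIdeal u.asIdeal (R := 𝓞 P.F), h1, h2]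

end Cor22

end Literature.IUT.LogVolume

end
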